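import Summits.ABC.IUTFork.Cor312ProvenanceL
import Literature.IUT.LogVolume.Corollary22Legendre
import Mathlib.LinearAlgebra.Complex.Module
import HarnessLib

/-!
# [IUTchIV] Theorem 1.10 (p. 22) "the `(3·5)`-torsion points of `E_F` are defined over `F`": the cell's FACT row
# F-2267 `Cor312Prov.TorsionFixed` on `Cor312ProvenanceL.lean` DECIDED in the kernel
# (abc-iut cell, D-0079 L-F sub-cell F6; typer-of-record lineage abc-iut-c312-8; PROOF-ONLY — no definition)

S. Mochizuki, *Inter-universal Teichmüller theory IV*, kurims manuscript (Apr. 2020), Thm. 1.10, p. 22 l. 27 ff.: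
"we assume that the `(3·5)`-torsion points of `E_F` are defined over `F`, and that
`F = F_mod(√−1, E_{F_mod}[2·3·5]) = F_tpd(√−1, E_{F_tpd}[3·5])`" [claim: Mochizuki2012, status: disputed]; Cor. 2.2
(ii), p. 42: "`F := F_tpd(√−1, E_{F_tpd}[3·5])`".  The statement file `Summits/ABC/IUTFork/Cor312ProvenanceL.lean`
(abc-iut-c312-8, p406561) types the hypothesis as the PARAMETRISED predicate
`Cor312Prov.TorsionFixed E F̄ n` — "every `F̄`-point of `E` killed by `n` is fixed by every `σ ∈ Aut(F̄/F)`" —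
and the frozen FACT-LIST carries it as row F-2267 (status `conditional`, via `TorsionFixed.of_dvd`).  A
parametrised predicate is a SCHEMA; the kernel decision is the pair below.

| row | predicate | universal closure | instance form at the printed model |
|---|---|---|---|
| F-2267 | `Cor312Prov.TorsionFixed E F̄ n` | REFUTED `Cor312Prov.not_forall_torsionFixed` (here): complex conjugation moves the `2`-torsion point `(i, 0)` of `y² = x³ + x` over `ℚ` | PROVED at EVERY theta field: for `P = (F_tpd, λ)` and `F = F_tpd(√−1, E[15])` in the tree's sense `Cor22.IsThetaField P F`, the Legendre curve `E_F = Cor22.thetaCurve P F` has `TorsionFixed E_F (AlgebraicClosure F) 15` (`torsionFixed_fifteen_thetaCurve`, here — it IS the clause `IsThetaField.torsion_rational`, the two typings of "Galois-fixed `15`-torsion" agreeing definitionally), hence for every `n ∣ 15` (`torsionFixed_thetaCurve_of_dvd`); this DISCHARGES BY NAME the binder `h15` of `Cor312ProvenancePoint` / `Cor312ProvenanceS` at `F̄ := AlgebraicClosure F` (`torsionFixed_fifteen_legendre_of_algebraMap`) |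

HONEST FRAMING.  Deciding a FACT row = OUR kernel check of OUR typed instance form; refuting a universal closure
refutes a schema reading, not the paper (print ASSUMES rational `15`-torsion by CHOOSING `F`; the instance form says
the tree's theta fields are so chosen).  Nothing here bears on [IUTchIII] Cor. 3.12 or takes a side; typed ≠ proved
elsewhere.  No definition, no instance, no notation.
-/

noncomputable section

namespace Summit.ABC.IUTFork.Cor312Prov

open Literature.IUT.LogVolume Literature.IUT.HodgeTheaters Literature.NumberTheory.DiophantineGeometry.GenEll

/-! ### F-2267, instance form PROVED at every theta field -/

section ThetaField

variable {P : NFPoint} {F : Type} [Field F] [NumberField F] [Algebra P.F F]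

/-- **F-2267 PROVED at the printed model**: for a theta field `F = F_tpd(√−1, E_{F_tpd}[3·5])` of the point
`P = (F_tpd, λ)` (`Cor22.IsThetaField P F`, Cor. 2.2 (ii) p. 42) the Legendre curve `E_F : y² = x(x−1)(x−λ)` over `F`
(`Cor22.thetaCurve P F`) has all its geometric `15`-torsion fixed by `Gal(F̄/F)`, `F̄ = AlgebraicClosure F` — i.e.
[IUTchIV] Thm. 1.10's hypothesis "the `(3·5)`-torsion points of `E_F` are defined over `F`" in the Galois-fixed form
`Cor312Prov.TorsionFixed`.  (abc-iut-L5-t2's `galoisAct E σ` and the tree's `σ • ·` on `WeierstrassCurve.geomPoints`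
are both `Affine.Point.map ↑σ`, so this is `IsThetaField.torsion_rational` read through the other typing.)
[claim: Mochizuki2012, status: disputed] -/
theorem torsionFixed_fifteen_thetaCurve (hF : Cor22.IsThetaField P F) :
    TorsionFixed (Cor22.thetaCurve P F) (AlgebraicClosure F) 15 :=
  fun σ T hT => hF.torsion_rational σ T hT

/-- Hence rational `n`-torsion of `E_F` over a theta field for every `n ∣ 15` (`n = 1, 3, 5, 15`; `TorsionFixed.of_dvd`,
p406561). [claim: Mochizuki2012, status: disputed] -/
theorem torsionFixed_thetaCurve_of_dvd (hF : Cor22.IsThetaField P F) {n : ℕ} (hn : n ∣ 15) :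
    TorsionFixed (Cor22.thetaCurve P F) (AlgebraicClosure F) n :=
  (torsionFixed_fifteen_thetaCurve hF).of_dvd hn

/-- The same instance in the LITERAL shape of the binder `h15` of `Cor312ProvenancePoint.display_legendre_of_torsion15` /
`display_legendre_of_algebraMap` / `Cor312ProvenanceS`: for a point `Q = (F, λ)` presenting `λ` over a theta field
`F = Q.F` of `P₀ = (F_tpd, λ)` (`Q.x = λ` via `algebraMap`), the Legendre literal `⟨0, −(1+λ), 0, λ, 0⟩` over `Q.F` has
Galois-fixed `15`-torsion over `F̄ := AlgebraicClosure Q.F` — the binder is DISCHARGED there for every theta field.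
[claim: Mochizuki2012, status: disputed] -/
theorem torsionFixed_fifteen_legendre_of_algebraMap {P₀ : NFPoint} (Q : NFPoint) [Algebra P₀.F Q.F]
    (hx : Q.x = algebraMap P₀.F Q.F P₀.x) (hF : Cor22.IsThetaField P₀ Q.F) :
    TorsionFixed (⟨0, -(1 + Q.x), 0, Q.x, 0⟩ : WeierstrassCurve Q.F) (AlgebraicClosure Q.F) 15 := by
  have hE : (⟨0, -(1 + Q.x), 0, Q.x, 0⟩ : WeierstrassCurve Q.F) = Cor22.thetaCurve P₀ Q.F := by
    rw [hx]
  rw [hE]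
  exact torsionFixed_fifteen_thetaCurve hF

/-- With abc-iut-L5-t2's initial Θ-datum over the theta field (any `K`, bad-place predicates `Pb`, prime `l`) the
printed inference "[IUTchI], Definition 3.1, (c) ⟹ `l ≠ 5`", hence `l ≥ 7` (p406561 `seven_le_l_of_torsion15_fixed`),
now holds with NO torsion hypothesis at a theta field. [claim: Mochizuki2012, status: disputed] -/
theorem seven_le_l_of_isThetaField (hF : Cor22.IsThetaField P F) {K : Type} [Field K] [NumberField K] [Algebra F K]
    [Algebra K (AlgebraicClosure F)] {l : ℕ} {Pb : BadPlacePredicates K} [(Cor22.thetaCurve P F).IsElliptic]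
    (D : InitialThetaData F K (AlgebraicClosure F) (Cor22.thetaCurve P F) l Pb) : 7 ≤ l :=
  seven_le_l_of_torsion15_fixed D (torsionFixed_fifteen_thetaCurve hF)

end ThetaField

/-! ### F-2267, universal closure REFUTED: complex conjugation on `y² = x³ + x` -/

/-- **F-2267, universal closure REFUTED** (toy over `F = ℚ`, `F̄ = ℂ`): on `E : y² = x³ + x` the point `(i, 0)` is
`2`-torsion (`y = 0`), and the `ℚ`-algebra automorphism "complex conjugation" of `ℂ` maps it to `(−i, 0) ≠ (i, 0)`.
So "every `n`-torsion point is Galois-fixed" is NOT a law of Weierstrass curves — print ASSUMES it (for `n = 15`) by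
the CHOICE of `F`. [claim: Mochizuki2012, status: disputed] -/
theorem not_forall_torsionFixed :
    ¬ ∀ (F : Type) [Field F] [NumberField F] (Fbar : Type) [Field Fbar] [Algebra F Fbar]
        (E : WeierstrassCurve F) (n : ℕ), TorsionFixed E Fbar n := by
  intro h
  -- the curve `y² = x³ + x` over `ℚ` and complex conjugation as a `ℚ`-algebra automorphism of `ℂ`
  let E : WeierstrassCurve ℚ := ⟨0, 0, 0, 1, 0⟩
  let σ : ℂ ≃ₐ[ℚ] ℂ := AlgEquiv.ofRingEquiv (f := Complex.conjAe.toRingEquiv) (fun q => by simp)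
  have hσ : ∀ z : ℂ, σ z = (starRingEnd ℂ) z := fun z => rfl
  -- the point `(i, 0)` of `E(ℂ)`: on the curve (`i³ + i = 0`) and nonsingular (`3i² + 1 = −2 ≠ 0`)
  have hns : (E.toAffine.baseChange ℂ).toAffine.Nonsingular Complex.I 0 := by
    rw [WeierstrassCurve.Affine.nonsingular_iff', WeierstrassCurve.Affine.equation_iff']
    refine ⟨?_, Or.inl ?_⟩
    · simp [E, pow_succ]
    · simp [E, Complex.I_sq]
      norm_num
  -- it is `2`-torsion (`y = 0 = −y − a₁x − a₃`)
  have hT2 : ((2 : ℕ) : ℤ) • (WeierstrassCurve.Affine.Point.some _ _ hns : GeomPoints ℂ E) = 0 := by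
    rw [Nat.cast_ofNat, two_zsmul]
    exact WeierstrassCurve.Affine.Point.add_self_of_Y_eq (by simp [E])
  -- so by the supposed law complex conjugation fixes it — but it maps `(i, 0)` to `(−i, 0)`
  have hfix := h ℚ ℂ E 2 σ _ hT2
  rw [galoisAct, WeierstrassCurve.Affine.Point.map_some] at hfix
  have hI : (σ : ℂ →ₐ[ℚ] ℂ) Complex.I = Complex.I := (WeierstrassCurve.Affine.Point.some.inj hfix).1
  rw [AlgEquiv.coe_toAlgHom, hσ, Complex.conj_I] at hI
  exact Complex.I_ne_zero (by linear_combination (-1 / 2 : ℂ) * hI)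

end Summit.ABC.IUTFork.Cor312Prov

end
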